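import Literature.AlgebraicGeometry.HodgeTheory.WeilTypeHodgeLieEigenspaceNoInvariantForm
import Literature.AlgebraicGeometry.Motives.HodgeLieWeilThreeThreeLine
import HarnessLib

/-!
# An abelian variety of Weil type `(n, d)`, `n` odd `≥ 3`, with `End⁰ = K`: the raising operators of `Lie Hg(H¹A) ⊗ ℂ` are not all injective on `W⁻` — no type-III / Mumford position on the `K`-eigenspaces (the r = n branch of the (n|n) WEIL square is empty; dimension 6: r ≤ 2)

Family `hodge`, layer `Literature/AlgebraicGeometry/HodgeTheory`, namespace `Literature.AlgebraicGeometry.HodgeTheory`. THEOREMS ONLY (no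
definition, no named fact, no `sorry`). Written for the cell `pub-hodgeav-hg6` (req-37 (A) Q2b; eng-4 g7, the abelian-variety reading of brick B1
of the (3|3) WEIL square, `HOME/jobs/WEIL33-eng4g7/DESIGN.md` §3). HONEST FRAMING: nothing here proves HC / `HC_AV` / `HC_CM` or the rung H2;
unconditional Hodge theory of complex abelian varieties on the tree's `H¹(A(ℂ); ℚ)` (`BettiUniverse.hodge exists_isReal_hodgeModel_holds _ 1`).

* §1 **`pullbackOne_mem_adjoin_of_finrank_endAlgebra_eq_two`** — for `φ ≫ φ = −d` (`d > 0`), `finrank_ℚ End⁰(A) = 2`, `dim A > 0`: EVERY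
  pull-back `u^*` on `H¹(A(ℂ); ℂ)` is a polynomial in `φ^*` (`End⁰(A) = K = ℚ(φ)`; Riemann `End_Hdg(H¹) = End⁰(A)` through R9
  `exists_eq_smul_one_add_smul_bettiMapHom` and the transport `conj_baseChange_pull_eq_pullbackOne`). This is the hypothesis `hE` of
  W2 (`IsWeilType.hodgeLie_inf_endAlg_eq_bot_of_centre_le`, …) and of L16b's row vocabulary, now DISCHARGED from `finrank End⁰ = 2`.
* §2 **`IsWeilType.exists_raising_not_injective`** — for `(A, φ)` of Weil type `(n, d)` with `n` ODD, `n ≥ 3` and `finrank_ℚ End⁰(A) = 2`: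
  some non-zero raising operator `B ∈ Lie Hg(H¹A) ⊗ ℂ` (`B V^{1,0} = 0`, `B V_ℂ ⊆ V^{1,0}`) kills a non-zero vector of
  `W⁻ = ker(φ^*_ℂ − i√d) ∩ H^{0,1}`. (B1b `WeilSquare.exists_raising_not_injective` with `𝔷 = 0` from W2, the multiplicities `(n, n)` from
  W2 + R9's dictionary, `dim_ℚ H¹ = 4n` with `8 ∤ 4n`.) For `n = 3` (Weil-type SIXFOLDS with `End⁰ = K`, TABLE X row 9 special AND general
  members): in the corner language of the (3|3) square, `r ≤ 2` — the Mumford / type-III position (Moonen–Zarhin (2.3)) does not occur.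
NOT here: the r = 1, 2 analysis (bricks Y1/Y2), anything about Hodge classes.

## References

* [MoonenZarhin1999LowDim] B. Moonen, Yu. Zarhin, Math. Ann. 315 (1999) = arXiv:math/9901113, §2 (2.3), §3 proof of Lemma (3.4).
* [vanGeemen1994HodgeAV] B. van Geemen, LNM 1594, 4.9 (Weil type `(n, d)`).
* [DeligneMilne1982Tannakian] P. Deligne, J. S. Milne, LNM 900, §6 Thm. 6.20 (Riemann: `H¹_B` fully faithful).
* [Deligne1982HodgeCycles] P. Deligne, LNM 900 (1982), I §3, §4 p. 30.
-/

noncomputable section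

open scoped TensorProduct
open CategoryTheory Module
open Literature.AlgebraicTopology.SingularHomology
open Literature.AlgebraicGeometry.Motives
open Literature.AlgebraicGeometry.Motives.HodgeStructure
open Literature.AlgebraicGeometry.ComplexMultiplication (bettiRep_of)
open Literature.AlgebraicGeometry.VanGeemen1994 (pullbackOne)
open Literature.AlgebraicGeometry.Milne1999 (centralizerAlgebra)

namespace Literature.AlgebraicGeometry.HodgeTheory

variable {A : AbelianVariety ℂ} {φ : A ⟶ A} {n d : ℕ}

/-! ### §1 `End⁰(A) = K` ⟹ every pull-back is a polynomial in `φ^*` -/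

/-- **`finrank_ℚ End⁰(A) = 2`, `φ ≫ φ = −d` ⟹ every `u^*` on `H¹(A(ℂ); ℂ)` lies in `ℂ[φ^*]`** (indeed `u^* = x + yφ^*` with
`x, y ∈ ℚ`): Riemann's `End_Hdg(H¹(A;ℚ)) = End⁰(A) = ℚ + ℚφ` (R9 `exists_eq_smul_one_add_smul_bettiMapHom`) transported to `H¹(A(ℂ); ℂ)`
(`conj_baseChange_pull_eq_pullbackOne`). [cite: DeligneMilne1982Tannakian, §6 Thm. 6.20] [cite: vanGeemen1994HodgeAV, 4.9 and Lemma 5.2] -/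
theorem pullbackOne_mem_adjoin_of_finrank_endAlgebra_eq_two (hd : 0 < d) (hφ : φ ≫ φ = -(d • 𝟙 A))
    (hE2 : Module.finrank ℚ A.endAlgebra = 2) (hA : 0 < A.dim) (u : A ⟶ A) :
    pullbackOne A u ∈ Algebra.adjoin ℂ {pullbackOne A φ} := by
  have huE : BettiUniverse.pull u.hom.hom.hom 1 ∈
      (BettiUniverse.hodge exists_isReal_hodgeModel_holds (AbelianVariety.isSmoothProjective_holds (A := A)) 1).endAlg := by
    have h := unop_bettiRep_mem_endAlg exists_isReal_hodgeModel_holds hodgePQ_independent_of_hodgeModel_holds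
      (AbelianVariety.endAlgebra.of A u)
    rwa [bettiRep_of, MulOpposite.unop_op] at h
  obtain ⟨x, y, hxy⟩ := exists_eq_smul_one_add_smul_bettiMapHom exists_isReal_hodgeModel_holds
    hodgePQ_independent_of_hodgeModel_holds hd hφ hE2 hA _ huE
  set β := ofRatClassBaseChangeEquiv (AbelianVariety.isSmoothProjective_holds (A := A)) 1 with hβ
  have hu : pullbackOne A u = β.conj ((BettiUniverse.pull u.hom.hom.hom 1).baseChange ℂ) :=
    (conj_baseChange_pull_eq_pullbackOne u).symm
  have hφ' : pullbackOne A φ = β.conj ((BettiUniverse.pull φ.hom.hom.hom 1).baseChange ℂ) :=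
    (conj_baseChange_pull_eq_pullbackOne φ).symm
  have h1 : (BettiUniverse.pull u.hom.hom.hom 1).baseChange ℂ =
      (x : ℂ) • (1 : Module.End ℂ (ℂ ⊗[ℚ] bettiCohomology A.X 1)) + (y : ℂ) • (BettiUniverse.pull φ.hom.hom.hom 1).baseChange ℂ := by
    rw [hxy, LinearMap.baseChange_add, LinearMap.baseChange_smul, LinearMap.baseChange_smul, LinearMap.baseChange_one,
      ← algebraMap_smul ℂ x, ← algebraMap_smul ℂ y, eq_ratCast, eq_ratCast]
  have heq : pullbackOne A u = (x : ℂ) • 1 + (y : ℂ) • pullbackOne A φ := by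
    rw [hu, h1, map_add, map_smul, map_smul, ← hφ', Module.End.one_eq_id, LinearEquiv.conj_id]
    rfl
  rw [heq]
  exact Subalgebra.add_mem _ (Subalgebra.smul_mem _ (Subalgebra.one_mem _) _)
    (Subalgebra.smul_mem _ (Algebra.self_mem_adjoin_singleton ℂ _) _)

/-! ### §2 No thin corner for Weil type `(n, d)`, `n` odd, `End⁰ = K` -/

section LieForm

variable [HodgeTensorFacts.{0, 0}]

/-- **For `(A, φ)` of Weil type `(n, d)`, `n` odd, `n ≥ 3`, with `End⁰(A) = K` (`finrank_ℚ End⁰(A) = 2`), some non-zero RAISING operator of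
`Lie Hg(H¹A) ⊗ ℂ` kills a non-zero vector of `W⁻ = ker(φ^*_ℂ − i√d) ∩ H^{0,1}`** — the raising corner of `(Lie Hg)_ℂ|_W` is NOT «thin»
(`r ≤ n − 1`; for sixfolds `r ≤ 2`): B1b `WeilSquare.exists_raising_not_injective` on `H¹(A(ℂ); ℚ)` with `𝔷(Lie Hg) = 0` (W2
`IsWeilType.hodgeLie_inf_endAlg_eq_bot_of_centre_le`, `hE` by §1), multiplicities `(n, n)` (W2 `IsWeilType.eigenMultiplicity_eq` / `_neg_eq`
through R9's dictionary), `dim_ℚ H¹ = 4n` (`finrank_bettiCohomology_one`), `8 ∤ 4n`. NO displayed hypothesis.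
[cite: MoonenZarhin1999LowDim, §2 (2.3) and §3 proof of Lemma (3.4)] [cite: vanGeemen1994HodgeAV, 4.9] -/
theorem IsWeilType.exists_raising_not_injective (h : IsWeilType A φ n d) (hodd : Odd n) (h3 : 3 ≤ n)
    (hE2 : Module.finrank ℚ A.endAlgebra = 2) :
    ∃ B ∈ (BettiUniverse.hodge exists_isReal_hodgeModel_holds (AbelianVariety.isSmoothProjective_holds (A := A)) 1).hodgeLieC,
      (∀ p ∈ (BettiUniverse.hodge exists_isReal_hodgeModel_holds (AbelianVariety.isSmoothProjective_holds (A := A)) 1).piece 1 0,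
          B p = 0) ∧
        (∀ v, B v ∈ (BettiUniverse.hodge exists_isReal_hodgeModel_holds (AbelianVariety.isSmoothProjective_holds (A := A)) 1).piece 1 0) ∧
        B ≠ 0 ∧
        ∃ w ∈ Module.End.eigenspace ((bettiCohomology.map φ.hom.hom.hom 1).hom.baseChange ℂ) (Complex.I * (Real.sqrt d : ℂ)) ⊓
            (BettiUniverse.hodge exists_isReal_hodgeModel_holds (AbelianVariety.isSmoothProjective_holds (A := A)) 1).piece 0 1,
          w ≠ 0 ∧ B w = 0 := by
  haveI : Module.Finite ℚ (bettiCohomology A.X 1) := finite_bettiCohomology_one A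
  have hA : 0 < A.dim := by rw [h.dim_eq]; omega
  haveI : Nontrivial (bettiCohomology A.X 1) := by
    apply Module.nontrivial_of_finrank_pos (R := ℚ)
    rw [finrank_bettiCohomology_one A]
    omega
  obtain ⟨hφE, hφ2, hE, hμ⟩ := h.bettiMapHom_facts_of_finrank_endAlgebra_eq_two hE2
  set H := BettiUniverse.hodge exists_isReal_hodgeModel_holds (AbelianVariety.isSmoothProjective_holds (A := A)) 1 with hHdef
  have heff : H.IsEffective := BettiUniverse.hodge_isEffective exists_isReal_hodgeModel_holds _ 1
  obtain ⟨ψ⟩ := BettiUniverse.hodge_isPolarizable exists_isReal_hodgeModel_holds (AbelianVariety.isSmoothProjective_holds (A := A)) 1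
  -- `𝔷 = 0` (W2, with `hE` from §1)
  have hz : H.hodgeLie ⊓ Subalgebra.toSubmodule H.endAlg = ⊥ :=
    h.hodgeLie_inf_endAlg_eq_bot_of_centre_le fun u _ =>
      pullbackOne_mem_adjoin_of_finrank_endAlgebra_eq_two h.d_pos h.sq_eq hE2 hA u
  -- the multiplicities `(n, n)` on `W`
  have hconj : starRingEnd ℂ (Complex.I * (Real.sqrt d : ℂ)) = -(Complex.I * (Real.sqrt d : ℂ)) := by
    rw [map_mul, Complex.conj_I, Complex.conj_ofReal, neg_mul]
  have hWp : Module.finrank ℂ ↥(Module.End.eigenspace ((bettiCohomology.map φ.hom.hom.hom 1).hom.baseChange ℂ)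
      (Complex.I * (Real.sqrt d : ℂ)) ⊓ H.piece 1 0) = n := by
    rw [hHdef, finrank_eigenspace_inf_piece_oneZero_eq_eigenMultiplicity exists_isReal_hodgeModel_holds
      hodgePQ_independent_of_hodgeModel_holds φ, h.eigenMultiplicity_eq]
  have hWm : Module.finrank ℂ ↥(Module.End.eigenspace ((bettiCohomology.map φ.hom.hom.hom 1).hom.baseChange ℂ)
      (Complex.I * (Real.sqrt d : ℂ)) ⊓ H.piece 0 1) = n := by
    rw [hHdef, finrank_eigenspace_inf_piece_zeroOne_eq_eigenMultiplicity_conj exists_isReal_hodgeModel_holds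
      hodgePQ_independent_of_hodgeModel_holds φ, hconj, h.eigenMultiplicity_neg_eq]
  -- `8 ∤ dim_ℚ H¹ = 4n` (`n` odd)
  have h8 : ¬ 8 ∣ Module.finrank ℚ (bettiCohomology A.X 1) := by
    rw [finrank_bettiCohomology_one A, h.dim_eq]
    obtain ⟨k, rfl⟩ := hodd
    omega
  exact WeilSquare.exists_raising_not_injective H rfl heff ψ hφE (Nat.cast_pos.2 h.d_pos) hφ2 hE hμ hz (by omega) hWp hWm h8

end LieForm

end Literature.AlgebraicGeometry.HodgeTheory

end
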